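import Mathlib
import Literature.Computability.AlgebraicComplexity.StandardFamilies
import Literature.Computability.AlgebraicComplexity.DeterminantalConormalBound
import Summits.ValiantsHypothesis.ValiantsHypothesis.Theorems.DetQPDetqpSuperquadraticStubBezoutGrowth

/-!
# Crux `RefutationBarrier` (stmt-ValiantsHypothesis-5642), line `Sketch_ideator5` (lead c2):
the research stub W is implied by crux 0318's sectional-class witness

`stub_sectionalWitnessQuad` (this line's research stub: for infinitely many `n`, a linear section
`per_n ∘ L` in `N ≥ 3` variables and a datum with more than `B(⌊n²/2⌋+1, N)` non-degenerate polar
points) follows from the registered research stub `stub_sectionalWitness` of crux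
`DetQP.DetqpSuperquadratic` (stmt-ValiantsHypothesis-0318, line `sectional-class-ladder`: for all
large `n`, at a rung `k ≥ n^{1+ε}`, at least `n^{(1-θ)k}` non-degenerate polar points, `0 < θ < ε`),
by the landed arithmetic `stub_bezoutGrowth` (`n^{(1-θ)k} ≤ B(m, k+2)` forces `m ≥ n^{2+(ε-θ)/2}`,
impossible for `m = ⌊n²/2⌋+1`).  One research statement thus serves both cruxes.  Statement-level
implication only (both sides are hypotheses/conclusions here; nothing is assumed proved).
-/

set_option linter.dupNamespace false

noncomputable section

namespace Summit.ValiantsHypothesis.ValiantsHypothesis.Theorems.RefutationDegree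

open scoped BigOperators
open MvPolynomial
open Literature.Computability.AlgebraicComplexity (perPoly polarSet conormalBezout)
open Summit.ValiantsHypothesis.ValiantsHypothesis.Theorems.DetQPDetqpSuperquadratic (stub_bezoutGrowth)

/-- Arithmetic: for `n ≥ 2` and `δ > 0`, `⌊n²/2⌋ + 1 < n^{2+δ}` (as reals). [folklore] -/
theorem quadSize_lt_rpow {n : ℕ} (hn : 2 ≤ n) {δ : ℝ} (hδ : 0 < δ) :
    ((n ^ 2 / 2 + 1 : ℕ) : ℝ) < (n : ℝ) ^ (2 + δ) := by
  have hn1 : (1 : ℝ) < n := by exact_mod_cast hn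
  have hn0 : (0 : ℝ) < n := by linarith
  have h1 : ((n ^ 2 / 2 + 1 : ℕ) : ℝ) ≤ (n : ℝ) ^ 2 / 2 + 1 := by
    have := Nat.cast_div_le (m := n ^ 2) (n := 2) (α := ℝ)
    push_cast at this ⊢
    linarith
  have h2 : (n : ℝ) ^ 2 / 2 + 1 ≤ (n : ℝ) ^ 2 := by
    have h4 : (4 : ℝ) ≤ (n : ℝ) ^ 2 := by
      have : (2 : ℝ) ≤ n := by exact_mod_cast hn
      nlinarith
    linarith
  have h3 : (n : ℝ) ^ 2 < (n : ℝ) ^ (2 + δ) := by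
    have hlt : (n : ℝ) ^ (2 : ℝ) < (n : ℝ) ^ (2 + δ) :=
      Real.rpow_lt_rpow_of_exponent_lt hn1 (by linarith)
    have heq : (n : ℝ) ^ (2 : ℝ) = (n : ℝ) ^ 2 := by
      rw [← Real.rpow_natCast]
      norm_num
    rw [heq] at hlt
    exact hlt
  linarith

/-- **W from crux 0318's sectional witness.**  If for some `0 < θ < ε` and all large `n` some
linear section `per_n ∘ L` in `k + 2` variables with `k ≥ n^{1+ε}` has a datum with at least
`n^{(1-θ)k}` non-degenerate polar points (the registered `stub_sectionalWitness` of
stmt-ValiantsHypothesis-0318, verbatim as hypothesis), then for infinitely many `n` some section in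
`N ≥ 3` variables has a datum with more than `B(⌊n²/2⌋+1, N)` non-degenerate polar points
(this line's `stub_sectionalWitnessQuad`, verbatim as conclusion): otherwise `stub_bezoutGrowth`
would give `n^{2+(ε-θ)/2} ≤ ⌊n²/2⌋+1`. -/
theorem sectionalWitnessQuad_of_witnessExp
    (h : ∃ ε θ : ℝ, 0 < θ ∧ θ < ε ∧ ∃ n₀ : ℕ, ∀ n ≥ n₀, ∃ k : ℕ, (n : ℝ) ^ (1 + ε) ≤ (k : ℝ) ∧
      ∃ L : Fin n × Fin n → MvPolynomial (Fin (k + 2)) ℂ, (∀ ij, (L ij).IsHomogeneous 1) ∧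
        ∃ (a b c : Fin (k + 2) → ℂ) (F : Finset (Fin (k + 2) → ℂ)),
          (∀ x ∈ F, x ∈ polarSet (aeval L (perPoly (Fin n) ℂ)) a b c ∧
            (Matrix.fromBlocks
              (Matrix.of fun i j : Fin (k + 2) =>
                eval x (pderiv i (pderiv j (aeval L (perPoly (Fin n) ℂ)))))
              (Matrix.of fun (i : Fin (k + 2)) (l : Fin 2) => ![a i, b i] l)
              (Matrix.of fun (l : Fin 2) (j : Fin (k + 2)) =>
                ![eval x (pderiv j (aeval L (perPoly (Fin n) ℂ))), c j] l)
              (0 : Matrix (Fin 2) (Fin 2) ℂ)).det ≠ 0) ∧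
          (n : ℝ) ^ ((1 - θ) * (k : ℝ)) ≤ (F.card : ℝ)) :
    ∀ n₀ : ℕ, ∃ n ≥ n₀, ∃ N : ℕ, 3 ≤ N ∧
      ∃ L : Fin n × Fin n → MvPolynomial (Fin N) ℂ, (∀ e, (L e).IsHomogeneous 1) ∧
        ∃ (a b c : Fin N → ℂ) (F : Finset (Fin N → ℂ)),
          (∀ x ∈ F, x ∈ polarSet (aeval L (perPoly (Fin n) ℂ)) a b c ∧
            (Matrix.fromBlocks
              (Matrix.of fun i j : Fin N =>
                eval x (pderiv i (pderiv j (aeval L (perPoly (Fin n) ℂ)))))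
              (Matrix.of fun (i : Fin N) (l : Fin 2) => ![a i, b i] l)
              (Matrix.of fun (l : Fin 2) (j : Fin N) =>
                ![eval x (pderiv j (aeval L (perPoly (Fin n) ℂ))), c j] l)
              (0 : Matrix (Fin 2) (Fin 2) ℂ)).det ≠ 0) ∧
          conormalBezout (n ^ 2 / 2 + 1) N < F.card := by
  obtain ⟨ε, θ, hθ, hθε, n₀, hW⟩ := h
  obtain ⟨n₁, hn₁⟩ := stub_bezoutGrowth ε θ hθ hθε
  intro n₀'
  set n : ℕ := max (max n₀ n₀') (max n₁ 2) with hn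
  have hn0 : n₀ ≤ n := le_trans (le_max_left _ _) (le_max_left _ _)
  have hn0' : n₀' ≤ n := le_trans (le_max_right _ _) (le_max_left _ _)
  have hn1 : n₁ ≤ n := le_trans (le_max_left _ _) (le_max_right _ _)
  have hn2 : 2 ≤ n := le_trans (le_max_right _ _) (le_max_right _ _)
  obtain ⟨k, hk, L, hL, a, b, c, F, hF, hcard⟩ := hW n hn0
  -- `k ≥ 1` since `k ≥ n^{1+ε} ≥ 1`
  have hk1 : 1 ≤ k := by
    have h1 : (1 : ℝ) ≤ (n : ℝ) ^ (1 + ε) :=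
      Real.one_le_rpow (by exact_mod_cast le_trans (by norm_num) hn2) (by linarith)
    have : (1 : ℝ) ≤ k := h1.trans hk
    exact_mod_cast this
  refine ⟨n, hn0', k + 2, by omega, L, hL, a, b, c, F, hF, ?_⟩
  by_contra hle
  push Not at hle
  have hle' : (n : ℝ) ^ ((1 - θ) * (k : ℝ)) ≤ (conormalBezout (n ^ 2 / 2 + 1) (k + 2) : ℝ) :=
    hcard.trans (by exact_mod_cast hle)
  have hm := hn₁ n hn1 k (n ^ 2 / 2 + 1) hk hle'
  have hlt := quadSize_lt_rpow hn2 (δ := (ε - θ) / 2) (by linarith)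
  linarith

end Summit.ValiantsHypothesis.ValiantsHypothesis.Theorems.RefutationDegree

end
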